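import Summits.QuantumFields.QCD.Theses.HeatSlicedQuarks

/-!
# Stub `stub_defectMinorBound` of line `Sketch`
(crux `Summit.QuantumFields.QCD.Theses.HeatSlicedQuarks.InterleavedHeatSliceFlow`, item stmt-QuantumFields-8891)

**Defect minor bound** (card pauli-pays-for-defect-modes, first lemma).  For a complex `n × n` matrix
`D`, `k ≤ n`, and injections `s t : Fin k ↪ Fin n`,

  `‖det D[s,t]‖² ≤ ∏_{i<k} λᵢ↓(Dᴴ D)`,

where `λ↓ = eigenvalues₀` are the eigenvalues of the Hermitian matrix `Dᴴ D` sorted decreasingly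
(`Matrix.IsHermitian.eigenvalues₀`, `Matrix.IsHermitian.eigenvalues₀_antitone`), i.e. the right-hand
side is the product of the squares of the `k` largest singular values of `D`.  Unnormalised Berezin
moments of a defect region are minors of `D`, so exact Grassmann integration never inverts a small
singular value (Horn–Johnson, *Matrix Analysis*, 2nd ed., Cor. 7.3.6 / Thm. 4.3.28: interlacing of the
singular values of a submatrix).

Proof (self-contained, Mathlib only; the tree and Mathlib have no Courant–Fischer / Cauchy
interlacing, so the needed "easy half" of the min–max principle is proved here at operator level).
Write `B = D[s,t]`, `G = Bᴴ B` (`k × k`), `H = Dᴴ D` (`n × n`), with decreasing eigenvalues `μ`, `λ` and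
sorted orthonormal eigenbases `u`, `b` (`LinearMap.IsSymmetric.eigenvectorBasis`).

* `‖det B‖² = det G = ∏ⱼ μⱼ` (`det_conjTranspose`, `IsHermitian.det_eq_prod_eigenvalues`), and all
  `μⱼ ≥ 0`; so it suffices to show `μⱼ ≤ λⱼ` for `j < k` and multiply (`Finset.prod_le_prod`).
* Rayleigh bounds (`defectMinorBound_re_inner_le` / `defectMinorBound_le_re_inner`): for a symmetric
  `T` with sorted eigenpairs `(λᵢ, bᵢ)`, `Re⟪v, T v⟫ = Σᵢ λᵢ |⟪bᵢ, v⟫|²`; hence `Re⟪v, Tv⟫ ≤ λⱼ ‖v‖²`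
  when `⟪bᵢ, v⟫ = 0` for `i < j`, and `λⱼ ‖v‖² ≤ Re⟪v, Tv⟫` when `⟪bᵢ, v⟫ = 0` for `i > j`.
* Dimension count (`defectMinorBound_eigenvalues₀_submatrix_le`): let `P : ℂᵏ → ℂⁿ` be extension by
  zero along `t` (an isometry, `Pᴴ P = 1`), so that `(D (P x)) (s a) = (B x) a` and therefore
  `‖B x‖² ≤ ‖D (P x)‖²`.  The linear map `x ↦ ((⟪uᵢ, x⟫)_{i>j}, (⟪bᵢ, P x⟫)_{i<j})` goes from `ℂᵏ` to a
  space of dimension `(k-1-j) + j = k-1 < k`, so it has a non-zero kernel vector `x`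
  (`LinearMap.ker_ne_bot_of_finrank_lt`), and then
  `μⱼ ‖x‖² ≤ Re⟪x, G x⟫ = ‖B x‖² ≤ ‖D (P x)‖² = Re⟪P x, H (P x)⟫ ≤ λⱼ ‖P x‖² = λⱼ ‖x‖²`.

Degenerate cases: `k = 0` reads `1 ≤ 1`; `k = n` is the equality `|det D|² = det (Dᴴ D)` weakened to
`≤`.  No named facts are used.
-/

namespace Summit.QuantumFields.QCD.Cruxes.InterleavedHeatSliceFlow.Sketch

open scoped Matrix InnerProductSpace ComplexConjugate

/-! ### Rayleigh-quotient bounds for a symmetric operator (easy half of Courant–Fischer) -/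

section Operator

variable {𝕜 : Type*} [RCLike 𝕜] {E : Type*} [NormedAddCommGroup E] [InnerProductSpace 𝕜 E]
  {m : ℕ}

/-- Parseval in coordinates: `‖v‖² = Σᵢ ‖(b.repr v) i‖²` for an orthonormal basis `b`. -/
private theorem defectMinorBound_norm_sq_eq_sum (b : OrthonormalBasis (Fin m) 𝕜 E) (v : E) :
    ‖v‖ ^ 2 = ∑ i, ‖b.repr v i‖ ^ 2 := by
  rw [← b.repr.norm_map v, EuclideanSpace.norm_sq_eq]

variable [FiniteDimensional 𝕜 E] {T : E →ₗ[𝕜] E}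

/-- Diagonalised quadratic form: for a symmetric `T` with sorted eigenvalues `λ` and eigenbasis
`b`, `Re⟪v, T v⟫ = Σᵢ λᵢ ‖(b.repr v) i‖²`. -/
private theorem defectMinorBound_re_inner_eq_sum (hT : T.IsSymmetric)
    (hm : Module.finrank 𝕜 E = m) (v : E) :
    RCLike.re ⟪v, T v⟫_𝕜 =
      ∑ i, hT.eigenvalues hm i * ‖(hT.eigenvectorBasis hm).repr v i‖ ^ 2 := by
  have h1 : ⟪v, T v⟫_𝕜 =
      ⟪(hT.eigenvectorBasis hm).repr v, (hT.eigenvectorBasis hm).repr (T v)⟫_𝕜 :=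
    ((hT.eigenvectorBasis hm).repr.inner_map_map _ _).symm
  rw [h1, PiLp.inner_apply, map_sum]
  refine Finset.sum_congr rfl fun i _ => ?_
  rw [hT.eigenvectorBasis_apply_self_apply hm v i, RCLike.inner_apply, mul_assoc,
    RCLike.mul_conj, ← RCLike.ofReal_pow, ← RCLike.ofReal_mul, RCLike.ofReal_re]

/-- **Easy half of Courant–Fischer, upper form.** If `v` is orthogonal to the first `j` sorted
eigenvectors of the symmetric operator `T` (those with the `j` largest eigenvalues), then
`Re⟪v, T v⟫ ≤ λⱼ ‖v‖²`. -/
private theorem defectMinorBound_re_inner_le (hT : T.IsSymmetric) (hm : Module.finrank 𝕜 E = m)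
    (j : Fin m) (v : E) (hv : ∀ i, i < j → (hT.eigenvectorBasis hm).repr v i = 0) :
    RCLike.re ⟪v, T v⟫_𝕜 ≤ hT.eigenvalues hm j * ‖v‖ ^ 2 := by
  rw [defectMinorBound_re_inner_eq_sum hT hm,
    defectMinorBound_norm_sq_eq_sum (hT.eigenvectorBasis hm), Finset.mul_sum]
  refine Finset.sum_le_sum fun i _ => ?_
  by_cases h : i < j
  · simp [hv i h]
  · exact mul_le_mul_of_nonneg_right (hT.eigenvalues_antitone hm (not_lt.mp h)) (sq_nonneg _)

/-- **Easy half of Courant–Fischer, lower form.** If `v` lies in the span of the first `j + 1`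
sorted eigenvectors of the symmetric operator `T` (i.e. is orthogonal to all later ones), then
`λⱼ ‖v‖² ≤ Re⟪v, T v⟫`. -/
private theorem defectMinorBound_le_re_inner (hT : T.IsSymmetric) (hm : Module.finrank 𝕜 E = m)
    (j : Fin m) (v : E) (hv : ∀ i, j < i → (hT.eigenvectorBasis hm).repr v i = 0) :
    hT.eigenvalues hm j * ‖v‖ ^ 2 ≤ RCLike.re ⟪v, T v⟫_𝕜 := by
  rw [defectMinorBound_re_inner_eq_sum hT hm,
    defectMinorBound_norm_sq_eq_sum (hT.eigenvectorBasis hm), Finset.mul_sum]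
  refine Finset.sum_le_sum fun i _ => ?_
  by_cases h : j < i
  · simp [hv i h]
  · exact mul_le_mul_of_nonneg_right (hT.eigenvalues_antitone hm (not_lt.mp h)) (sq_nonneg _)

end Operator

/-! ### Matrices on Euclidean space: Gram forms and extension by zero -/

section Embed

variable {n k : ℕ}

/-- `⟪y, (Mᴴ M) y⟫ = ⟪M y, M y⟫` on Euclidean space (`Mᴴ` acts as the adjoint). -/
private theorem defectMinorBound_inner_conjTranspose_mul_self {p q : Type*} [Fintype p]
    [Fintype q] [DecidableEq p] [DecidableEq q] (M : Matrix p q ℂ) (y : EuclideanSpace ℂ q) :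
    ⟪y, Matrix.toEuclideanLin (Mᴴ * M) y⟫_ℂ =
      ⟪Matrix.toEuclideanLin M y, Matrix.toEuclideanLin M y⟫_ℂ := by
  rw [Matrix.toLpLin_mul_same, LinearMap.comp_apply,
    Matrix.toEuclideanLin_conjTranspose_eq_adjoint, LinearMap.adjoint_inner_right]

/-- `Re⟪y, (Mᴴ M) y⟫ = ‖M y‖²` on Euclidean space. -/
private theorem defectMinorBound_re_inner_conjTranspose_mul_self {p q : Type*} [Fintype p]
    [Fintype q] [DecidableEq p] [DecidableEq q] (M : Matrix p q ℂ) (y : EuclideanSpace ℂ q) :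
    RCLike.re ⟪y, Matrix.toEuclideanLin (Mᴴ * M) y⟫_ℂ = ‖Matrix.toEuclideanLin M y‖ ^ 2 := by
  rw [defectMinorBound_inner_conjTranspose_mul_self, inner_self_eq_norm_sq (𝕜 := ℂ)]

/-- The sorted eigenvalues `eigenvalues₀` of a Gram matrix `Mᴴ M` are non-negative. -/
private theorem defectMinorBound_eigenvalues₀_nonneg {p q : Type*} [Fintype p] [Fintype q]
    [DecidableEq p] [DecidableEq q] (M : Matrix p q ℂ) (j : Fin (Fintype.card q)) :
    0 ≤ (Matrix.isHermitian_conjTranspose_mul_self M).eigenvalues₀ j := by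
  have := Matrix.eigenvalues_conjTranspose_mul_self_nonneg M
    (Fintype.equivOfCardEq (Fintype.card_fin _) j)
  simpa [Matrix.IsHermitian.eigenvalues] using this

/-- Extension by zero along `t : Fin k ↪ Fin n` is the `n × k` matrix `P = 1[·, t]` (columns
`e_{t c}`; written inline as `(1 : Matrix (Fin n) (Fin n) ℂ).submatrix (Equiv.refl _) t` throughout,
no definition is introduced).  It is an isometry: `Pᴴ P = 1`. -/
private theorem defectMinorBound_P_conjTranspose_mul_self (t : Fin k ↪ Fin n) :
    ((1 : Matrix (Fin n) (Fin n) ℂ).submatrix (Equiv.refl _) t)ᴴ *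
      (1 : Matrix (Fin n) (Fin n) ℂ).submatrix (Equiv.refl _) t = 1 := by
  rw [Matrix.conjTranspose_submatrix, Matrix.conjTranspose_one, Matrix.submatrix_mul_equiv,
    Matrix.mul_one, Matrix.submatrix_one_embedding]

/-- `D P = D[·, t]`: acting on an extended vector only sees the columns `t`. -/
private theorem defectMinorBound_mul_P (D : Matrix (Fin n) (Fin n) ℂ) (t : Fin k ↪ Fin n) :
    D * (1 : Matrix (Fin n) (Fin n) ℂ).submatrix (Equiv.refl _) t = D.submatrix id t := by
  rw [Matrix.mul_submatrix_one]
  rfl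

/-- `‖P x‖² = ‖x‖²` for the extension by zero `P`. -/
private theorem defectMinorBound_norm_sq_P (t : Fin k ↪ Fin n) (x : EuclideanSpace ℂ (Fin k)) :
    ‖Matrix.toEuclideanLin ((1 : Matrix (Fin n) (Fin n) ℂ).submatrix (Equiv.refl _) t) x‖ ^ 2 =
      ‖x‖ ^ 2 := by
  rw [← defectMinorBound_re_inner_conjTranspose_mul_self,
    defectMinorBound_P_conjTranspose_mul_self, Matrix.toLpLin_one, LinearMap.id_apply,
    inner_self_eq_norm_sq (𝕜 := ℂ)]

/-- `(D[s,t] x) a = (D (P x)) (s a)`: the submatrix acts as `D` on the extended vector, read off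
along the rows `s`. -/
private theorem defectMinorBound_apply_eq (D : Matrix (Fin n) (Fin n) ℂ) (s t : Fin k ↪ Fin n)
    (x : EuclideanSpace ℂ (Fin k)) (a : Fin k) :
    (Matrix.toEuclideanLin (D.submatrix s t) x) a =
      (Matrix.toEuclideanLin D (Matrix.toEuclideanLin
        ((1 : Matrix (Fin n) (Fin n) ℂ).submatrix (Equiv.refl _) t) x)) (s a) := by
  simp only [Matrix.toLpLin_apply, Matrix.mulVec_mulVec, WithLp.ofLp_toLp, defectMinorBound_mul_P]
  rfl

/-- `‖D[s,t] x‖² ≤ ‖D (P x)‖²`: dropping the rows outside `s` only decreases the norm. -/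
private theorem defectMinorBound_norm_sq_submatrix_le (D : Matrix (Fin n) (Fin n) ℂ)
    (s t : Fin k ↪ Fin n) (x : EuclideanSpace ℂ (Fin k)) :
    ‖Matrix.toEuclideanLin (D.submatrix s t) x‖ ^ 2 ≤
      ‖Matrix.toEuclideanLin D (Matrix.toEuclideanLin
        ((1 : Matrix (Fin n) (Fin n) ℂ).submatrix (Equiv.refl _) t) x)‖ ^ 2 := by
  rw [EuclideanSpace.norm_sq_eq, EuclideanSpace.norm_sq_eq]
  simp_rw [defectMinorBound_apply_eq D s t x]
  rw [← Finset.sum_map Finset.univ s (fun r => ‖(Matrix.toEuclideanLin D (Matrix.toEuclideanLin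
    ((1 : Matrix (Fin n) (Fin n) ℂ).submatrix (Equiv.refl _) t) x)) r‖ ^ 2)]
  exact Finset.sum_le_sum_of_subset_of_nonneg (Finset.subset_univ _) fun _ _ _ => sq_nonneg _

end Embed

/-! ### Interlacing and the minor bound -/

section Main

variable {n k : ℕ}

/-- **Interlacing of singular values of a submatrix, upper half** (Horn–Johnson Cor. 7.3.6, the
inequality `σⱼ(D[s,t]) ≤ σⱼ(D)` in squared form): the `j`-th largest eigenvalue of
`D[s,t]ᴴ D[s,t]` is at most the `j`-th largest eigenvalue of `Dᴴ D` (indices compared through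
their values, `(j' : ℕ) = j`).  Proof by the dimension count described in the module docstring. -/
private theorem defectMinorBound_eigenvalues₀_submatrix_le (D : Matrix (Fin n) (Fin n) ℂ)
    (s t : Fin k ↪ Fin n) (j : Fin (Fintype.card (Fin k))) (j' : Fin (Fintype.card (Fin n)))
    (hjj' : (j' : ℕ) = j) :
    (Matrix.isHermitian_conjTranspose_mul_self (D.submatrix s t)).eigenvalues₀ j ≤
      (Matrix.isHermitian_conjTranspose_mul_self D).eigenvalues₀ j' := by
  set B := D.submatrix s t with hB
  have hTG : (Matrix.toEuclideanLin (Bᴴ * B)).IsSymmetric :=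
    Matrix.isSymmetric_toEuclideanLin_iff.mpr (Matrix.isHermitian_conjTranspose_mul_self B)
  have hTH : (Matrix.toEuclideanLin (Dᴴ * D)).IsSymmetric :=
    Matrix.isSymmetric_toEuclideanLin_iff.mpr (Matrix.isHermitian_conjTranspose_mul_self D)
  change hTG.eigenvalues finrank_euclideanSpace j ≤ hTH.eigenvalues finrank_euclideanSpace j'
  set bG := hTG.eigenvectorBasis finrank_euclideanSpace with hbG
  set bH := hTH.eigenvectorBasis finrank_euclideanSpace with hbH
  set P := Matrix.toEuclideanLin ((1 : Matrix (Fin n) (Fin n) ℂ).submatrix (Equiv.refl _) t)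
    with hP
  -- the `k - 1` linear constraints
  let Φ : EuclideanSpace ℂ (Fin k) →ₗ[ℂ]
      ({i : Fin (Fintype.card (Fin k)) // j < i} → ℂ) ×
        ({i : Fin (Fintype.card (Fin n)) // i < j'} → ℂ) :=
    LinearMap.prod
      (LinearMap.pi fun i =>
        (EuclideanSpace.projₗ (𝕜 := ℂ) i.1) ∘ₗ bG.repr.toLinearEquiv.toLinearMap)
      (LinearMap.pi fun i =>
        (EuclideanSpace.projₗ (𝕜 := ℂ) i.1) ∘ₗ bH.repr.toLinearEquiv.toLinearMap ∘ₗ P)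
  have hdim : Module.finrank ℂ (({i : Fin (Fintype.card (Fin k)) // j < i} → ℂ) ×
      ({i : Fin (Fintype.card (Fin n)) // i < j'} → ℂ)) <
      Module.finrank ℂ (EuclideanSpace ℂ (Fin k)) := by
    have h1 : Fintype.card {i : Fin (Fintype.card (Fin k)) // j < i} =
        Fintype.card (Fin k) - 1 - j := by
      rw [Fintype.card_subtype, Finset.filter_lt_eq_Ioi, Fin.card_Ioi]
    have h2 : Fintype.card {i : Fin (Fintype.card (Fin n)) // i < j'} = j' := by
      rw [Fintype.card_subtype, Finset.filter_gt_eq_Iio, Fin.card_Iio]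
    rw [Module.finrank_prod, Module.finrank_fintype_fun_eq_card,
      Module.finrank_fintype_fun_eq_card, finrank_euclideanSpace, h1, h2, hjj']
    have := j.2
    simp only [Fintype.card_fin] at this ⊢
    omega
  -- a non-zero vector satisfying all constraints
  obtain ⟨x, hxker, hx0⟩ :=
    (Submodule.ne_bot_iff _).mp (LinearMap.ker_ne_bot_of_finrank_lt hdim)
  have hΦ : Φ x = 0 := LinearMap.mem_ker.mp hxker
  have hx1 : ∀ i, j < i → bG.repr x i = 0 := fun i hi => by
    have := congr_fun (congr_arg Prod.fst hΦ) ⟨i, hi⟩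
    simpa [Φ] using this
  have hx2 : ∀ i, i < j' → bH.repr (P x) i = 0 := fun i hi => by
    have := congr_fun (congr_arg Prod.snd hΦ) ⟨i, hi⟩
    simpa [Φ] using this
  -- the Rayleigh chain
  have c1 := defectMinorBound_le_re_inner hTG finrank_euclideanSpace j x hx1
  have c2 := defectMinorBound_re_inner_conjTranspose_mul_self B x
  have c3 := defectMinorBound_norm_sq_submatrix_le D s t x
  have c4 := defectMinorBound_re_inner_conjTranspose_mul_self D (P x)
  have c5 := defectMinorBound_re_inner_le hTH finrank_euclideanSpace j' (P x) hx2
  have c6 := defectMinorBound_norm_sq_P t x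
  have hpos : 0 < ‖x‖ ^ 2 := pow_pos (norm_pos_iff.mpr hx0) 2
  refine le_of_mul_le_mul_right ?_ hpos
  calc hTG.eigenvalues finrank_euclideanSpace j * ‖x‖ ^ 2
      ≤ RCLike.re ⟪x, Matrix.toEuclideanLin (Bᴴ * B) x⟫_ℂ := c1
    _ = ‖Matrix.toEuclideanLin B x‖ ^ 2 := c2
    _ ≤ ‖Matrix.toEuclideanLin D (P x)‖ ^ 2 := c3
    _ = RCLike.re ⟪P x, Matrix.toEuclideanLin (Dᴴ * D) (P x)⟫_ℂ := c4.symm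
    _ ≤ hTH.eigenvalues finrank_euclideanSpace j' * ‖P x‖ ^ 2 := c5
    _ = hTH.eigenvalues finrank_euclideanSpace j' * ‖x‖ ^ 2 := by rw [c6]

/-- **Defect minor bound** (registered stub `stub_defectMinorBound` of line `Sketch`; card
pauli-pays-for-defect-modes, first lemma): every `k × k` minor of a complex `n × n` matrix `D` is
bounded by the product of the `k` largest singular values of `D`, in squared form
`‖det D[s,t]‖² ≤ ∏_{i<k} eigenvalues₀ (Dᴴ D) i` with `eigenvalues₀` sorted decreasingly
(Horn–Johnson, *Matrix Analysis*, 2nd ed., Cor. 7.3.6).  Proof: `‖det D[s,t]‖² = det (BᴴB) = ∏ⱼ μⱼ`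
for `B = D[s,t]`, every `μⱼ ≥ 0`, and `μⱼ ≤ λⱼ(Dᴴ D)` termwise by
`defectMinorBound_eigenvalues₀_submatrix_le`. -/
theorem stub_defectMinorBound :
    ∀ (n k : ℕ) (hk : k ≤ n) (D : Matrix (Fin n) (Fin n) ℂ) (s t : Fin k ↪ Fin n),
      ‖(D.submatrix s t).det‖ ^ 2 ≤
        ∏ i : Fin k, (Matrix.isHermitian_conjTranspose_mul_self D).eigenvalues₀
          (Fin.cast (Fintype.card_fin n).symm (Fin.castLE hk i)) := by
  intro n k hk D s t
  set B := D.submatrix s t with hB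
  have hG : (Bᴴ * B).IsHermitian := Matrix.isHermitian_conjTranspose_mul_self B
  -- `‖det B‖² = det (Bᴴ B) = ∏ eigenvalues = ∏ eigenvalues₀`
  have h1 : (Bᴴ * B).det = ((‖B.det‖ ^ 2 : ℝ) : ℂ) := by
    rw [Matrix.det_mul, Matrix.det_conjTranspose, Complex.star_def, Complex.conj_mul',
      Complex.ofReal_pow]
  have h2 : ((‖B.det‖ ^ 2 : ℝ) : ℂ) = ∏ i, (hG.eigenvalues i : ℂ) := by
    rw [← h1]; exact hG.det_eq_prod_eigenvalues
  have h3 : ‖B.det‖ ^ 2 = ∏ i, hG.eigenvalues i := by exact_mod_cast h2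
  have h4 : ∏ i : Fin k, hG.eigenvalues i =
      ∏ j : Fin (Fintype.card (Fin k)), hG.eigenvalues₀ j :=
    Fintype.prod_equiv (Fintype.equivOfCardEq (α := Fin (Fintype.card (Fin k))) (β := Fin k)
      (Fintype.card_fin _)).symm _ _ fun _ => rfl
  have h5 : ∏ i : Fin k, hG.eigenvalues₀ (Fin.cast (Fintype.card_fin k).symm i) =
      ∏ j : Fin (Fintype.card (Fin k)), hG.eigenvalues₀ j :=
    Fintype.prod_equiv (finCongr (Fintype.card_fin k).symm) _ _ fun _ => rfl
  rw [h3, h4, ← h5]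
  -- termwise comparison of non-negative factors
  refine Finset.prod_le_prod (fun i _ => defectMinorBound_eigenvalues₀_nonneg B _) fun i _ => ?_
  exact defectMinorBound_eigenvalues₀_submatrix_le D s t _ _ (by simp)

end Main

end Summit.QuantumFields.QCD.Cruxes.InterleavedHeatSliceFlow.Sketch
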